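import Summits.AnomalousDissipation.AnomalousDissipation.Theorems.SolenoidalFractalHomogenisationLagrangianStepCellLawVOddGainDefectSlotScalars
import HarnessLib

/-!
# K1L `LagrangianRenormalisationStep(Design)` (K1L_D, stmt-AnomalousDissipation-27980; aside 24912), stub `stub_cellLawV0_IS`
# — W5 odd half, O2⁺ (v): the SECOND kernel moment in closed form, `h_T(a) ≤ 2ϑ_∞/a³` (sharp), for the second-order lower edge

(helper; `--supports stmt-AnomalousDissipation-27980`)

Summits-side helper file of route `SolenoidalFractalHomogenisation` (prover seat `ad-k1l-cellLawV-w1` g2), companion of `…CellLawVOddGainDefectSlotScalars`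
(p655589): the closed-form bound of the SECOND kernel moment that multiplies the `O(τ²)` loss of `lowerEdge_second_order` (p654671),
`h_T(a) := T∫₀¹a(s)∫₀ˢa(x)(T(s−x))²e^{−T(s−x)a}dxds` (written out, no definition):
* `hasDerivAt_exp_neg_kernel`; `kernel_moment2_mass_le` — `T∫₀ˢ(T(s−x))²e^{−T(s−x)a}dx = (2 − ((Tsa)²+2Tsa+2)e^{−Tsa})/a³ ≤ 2/a³`
  (explicit antiderivative);
* `kernel_moment2_dual_le` — the `a(x)²` half WITHOUT Fubini: `T∫₀¹∫₀ˢψ(x)(T(s−x))²e^{−T(s−x)a} = 2∫₀¹ψ/a³ − Φ₂(1) ≤ 2∫₀¹ψ/a³` through the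
  potential `Φ₂(s) = ∫₀ˢψ(x)((T(s−x))²/a + 2T(s−x)/a² + 2/a³)e^{−T(s−x)a}dx` written in the primitives `∫₀ˢe^{Tax}ψ`, `∫₀ˢe^{Tax}xψ`, `∫₀ˢe^{Tax}x²ψ`;
* **`qsRespMoment2_le`: `h_T(a) ≤ 2ϑ_∞/a³`**, `ϑ_∞ = 1 − 4ρ/3` (`0 < ρ ≤ 1/2`, `T ≥ 0`, `a > 0`) — SHARP (attained as `T → ∞`); so the second-order
  lower edge reads `vᵀf_T(B)v ≥ (f_T(hi) − (τhi)²ϑ_∞/(4lo³))|v|²`, relative loss `≈ τ²(hi/lo)³/4` (the profile's `0.25τ²` at `hi = lo`).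
Everything PROVED, no definition, no named fact, no sorry.  Infrastructure for route-1's rung leaf F-D1.A0 (frontier FORMAL rung); NOT a proof of the
stub, of the crux, of Onsager's conjecture or of anomalous dissipation.  Prover seat `ad-k1l-cellLawV-w1` g2, 2026-08-28.
-/

set_option linter.dupNamespace false

noncomputable section

namespace Summit.AnomalousDissipation.AnomalousDissipation.Theorems.SolenoidalFractalHomogenisation.LagrangianStep.OddGain

open Matrix Finset MeasureTheory Set
open Literature.Analysis Literature.Analysis.FunctionSpaces Literature.Analysis.FluidPDE
open Literature.Analysis.FluidPDE.LatticeShear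

/-! ## §8 The second kernel moment `h_T(a) = T∫₀¹a(s)∫₀ˢa(x)(T(s−x))²e^{−T(s−x)a}dxds ≤ 2ϑ_∞/a³` -/

section SecondMoment

/-- Derivative of the kernel exponential in the inner variable: `d/dx e^{−T(s−x)a} = Ta·e^{−T(s−x)a}`. [folklore] -/
theorem hasDerivAt_exp_neg_kernel (T a s x : ℝ) :
    HasDerivAt (fun x : ℝ => Real.exp (-(T * (s - x)) * a)) (Real.exp (-(T * (s - x)) * a) * (T * a)) x := by
  have hf : (fun x : ℝ => Real.exp (-(T * (s - x)) * a)) = fun x => Real.exp (T * a * x - T * a * s) := by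
    ext y; congr 1; ring
  have hlin : HasDerivAt (fun x : ℝ => T * a * x - T * a * s) (T * a) x := by
    simpa using ((hasDerivAt_id x).const_mul (T * a)).sub_const (T * a * s)
  rw [hf]
  refine hlin.exp.congr_deriv ?_
  rw [show T * a * x - T * a * s = -(T * (s - x)) * a by ring]

/-- The mass of the second-moment kernel on a slot: `T∫₀ˢ (T(s−x))²e^{−T(s−x)a}dx = (2 − ((Tsa)² + 2Tsa + 2)e^{−Tsa})/a³ ≤ 2/a³`
(`s ≥ 0`, `a > 0`; antiderivative `((T(s−x))²/a + 2T(s−x)/a² + 2/a³)e^{−T(s−x)a}`). [folklore] -/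
theorem kernel_moment2_mass_le {T a : ℝ} (ha : 0 < a) (hT : 0 ≤ T) {s : ℝ} (hs : 0 ≤ s) :
    T * ∫ x in (0:ℝ)..s, (T * (s - x)) ^ 2 * Real.exp (-(T * (s - x)) * a) ≤ 2 / a ^ 3 := by
  have hG : ∀ x ∈ uIcc (0:ℝ) s, HasDerivAt (fun x : ℝ => (T ^ 2 / a * ((s - x) * (s - x)) + 2 * T / a ^ 2 * (s - x) + 2 / a ^ 3) *
      Real.exp (-(T * (s - x)) * a)) (T * ((T * (s - x)) ^ 2 * Real.exp (-(T * (s - x)) * a))) x := by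
    intro x _
    have hsx : HasDerivAt (fun x : ℝ => s - x) (-1) x := (hasDerivAt_id' x).const_sub s
    have hP : HasDerivAt (fun x : ℝ => T ^ 2 / a * ((s - x) * (s - x)) + 2 * T / a ^ 2 * (s - x) + 2 / a ^ 3)
        (T ^ 2 / a * ((-1) * (s - x) + (s - x) * (-1)) + 2 * T / a ^ 2 * (-1)) x :=
      (((hsx.mul hsx).const_mul _).add (hsx.const_mul _)).add_const _
    have h := hP.mul (hasDerivAt_exp_neg_kernel T a s x)
    refine h.congr_deriv ?_
    field_simp
    ring
  rw [← intervalIntegral.integral_const_mul, intervalIntegral.integral_eq_sub_of_hasDerivAt hG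
    ((by fun_prop : Continuous fun x : ℝ => T * ((T * (s - x)) ^ 2 * Real.exp (-(T * (s - x)) * a))).intervalIntegrable _ _)]
  simp only [sub_self, sub_zero, mul_zero, zero_mul, add_zero, zero_add, neg_zero, Real.exp_zero, mul_one]
  have hpos : 0 ≤ (T ^ 2 / a * (s * s) + 2 * T / a ^ 2 * s + 2 / a ^ 3) * Real.exp (-(T * s) * a) := by positivity
  linarith

/-- The DUAL second-moment bound (the `a(x)²` half of AM–GM, WITHOUT Fubini): for a continuous `ψ ≥ 0` on `[0,1]`,
`T∫₀¹∫₀ˢψ(x)(T(s−x))²e^{−T(s−x)a}dxds = 2∫₀¹ψ/a³ − Φ₂(1) ≤ 2∫₀¹ψ/a³`, `Φ₂(s) = ∫₀ˢψ(x)((T(s−x))²/a + 2T(s−x)/a² + 2/a³)e^{−T(s−x)a}dx`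
(written through the primitives `∫₀ˢe^{Tax}ψ`, `∫₀ˢe^{Tax}xψ`, `∫₀ˢe^{Tax}x²ψ`). [folklore] -/
theorem kernel_moment2_dual_le {T a : ℝ} (ha : 0 < a) (hT : 0 ≤ T) {ψ : ℝ → ℝ} (hψ : Continuous ψ) (hψ0 : ∀ x ∈ Icc (0:ℝ) 1, 0 ≤ ψ x) :
    T * ∫ s in (0:ℝ)..1, ∫ x in (0:ℝ)..s, ψ x * ((T * (s - x)) ^ 2 * Real.exp (-(T * (s - x)) * a)) ≤
      2 * (∫ s in (0:ℝ)..1, ψ s) / a ^ 3 := by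
  set A : ℝ → ℝ := fun s => ∫ x in (0:ℝ)..s, Real.exp ((T * a) * x) * ψ x with hA
  set B : ℝ → ℝ := fun s => ∫ x in (0:ℝ)..s, Real.exp ((T * a) * x) * (x * ψ x) with hB
  set C : ℝ → ℝ := fun s => ∫ x in (0:ℝ)..s, Real.exp ((T * a) * x) * (x ^ 2 * ψ x) with hC
  have hcA : Continuous fun x => Real.exp ((T * a) * x) * ψ x := by fun_prop
  have hcB : Continuous fun x => Real.exp ((T * a) * x) * (x * ψ x) := by fun_prop
  have hcC : Continuous fun x => Real.exp ((T * a) * x) * (x ^ 2 * ψ x) := by fun_prop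
  have hdA : ∀ s, HasDerivAt A (Real.exp ((T * a) * s) * ψ s) s := fun s => (hcA.integral_hasStrictDerivAt 0 s).hasDerivAt
  have hdB : ∀ s, HasDerivAt B (Real.exp ((T * a) * s) * (s * ψ s)) s := fun s => (hcB.integral_hasStrictDerivAt 0 s).hasDerivAt
  have hdC : ∀ s, HasDerivAt C (Real.exp ((T * a) * s) * (s ^ 2 * ψ s)) s := fun s => (hcC.integral_hasStrictDerivAt 0 s).hasDerivAt
  have hcA' : Continuous A := continuous_iff_continuousAt.2 fun s => (hdA s).continuousAt
  have hcB' : Continuous B := continuous_iff_continuousAt.2 fun s => (hdB s).continuousAt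
  have hcC' : Continuous C := continuous_iff_continuousAt.2 fun s => (hdC s).continuousAt
  have hA0 : A 0 = 0 := by simp [hA]
  have hB0 : B 0 = 0 := by simp [hB]
  have hC0 : C 0 = 0 := by simp [hC]
  -- the bridge: the kernel integral through `A`, `B`, `C`
  have hbridge : ∀ s : ℝ, ∫ x in (0:ℝ)..s, ψ x * ((T * (s - x)) ^ 2 * Real.exp (-(T * (s - x)) * a)) =
      T ^ 2 * Real.exp (-(T * a) * s) * (s ^ 2 * A s - 2 * s * B s + C s) := by
    intro s
    show _ = T ^ 2 * Real.exp (-(T * a) * s) * (s ^ 2 * (∫ x in (0:ℝ)..s, Real.exp ((T * a) * x) * ψ x) -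
      2 * s * (∫ x in (0:ℝ)..s, Real.exp ((T * a) * x) * (x * ψ x)) + ∫ x in (0:ℝ)..s, Real.exp ((T * a) * x) * (x ^ 2 * ψ x))
    rw [← intervalIntegral.integral_const_mul, ← intervalIntegral.integral_const_mul,
      ← intervalIntegral.integral_sub ((hcA.intervalIntegrable _ _).const_mul _) ((hcB.intervalIntegrable _ _).const_mul _),
      ← intervalIntegral.integral_add (((hcA.intervalIntegrable _ _).const_mul _).sub ((hcB.intervalIntegrable _ _).const_mul _))
        (hcC.intervalIntegrable _ _), ← intervalIntegral.integral_const_mul]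
    refine intervalIntegral.integral_congr fun x _ => ?_
    have he : Real.exp (-(T * (s - x)) * a) = Real.exp (-(T * a) * s) * Real.exp ((T * a) * x) := by
      rw [← Real.exp_add]; congr 1; ring
    simp only [he]
    ring
  -- the potential `Φ₂` and its derivative
  set Φ : ℝ → ℝ := fun s => Real.exp (-(T * a) * s) *
    ((T ^ 2 * s ^ 2 / a + 2 * T * s / a ^ 2 + 2 / a ^ 3) * A s - (2 * T ^ 2 * s / a + 2 * T / a ^ 2) * B s + T ^ 2 / a * C s) with hΦ
  have hdΦ : ∀ s, HasDerivAt Φ (2 * ψ s / a ^ 3 - T * (T ^ 2 * Real.exp (-(T * a) * s) * (s ^ 2 * A s - 2 * s * B s + C s))) s := by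
    intro s
    have h1 : HasDerivAt (fun s : ℝ => Real.exp (-(T * a) * s)) (Real.exp (-(T * a) * s) * (-(T * a))) s := by
      have := ((hasDerivAt_id s).const_mul (-(T * a))).exp
      simpa using this
    have hs1 : HasDerivAt (fun s : ℝ => s) 1 s := hasDerivAt_id' s
    have hα : HasDerivAt (fun s : ℝ => T ^ 2 * s ^ 2 / a + 2 * T * s / a ^ 2 + 2 / a ^ 3) (2 * T ^ 2 * s / a + 2 * T / a ^ 2) s := by
      have hf : (fun s : ℝ => T ^ 2 * s ^ 2 / a + 2 * T * s / a ^ 2 + 2 / a ^ 3) =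
          fun s => T ^ 2 / a * (s * s) + 2 * T / a ^ 2 * s + 2 / a ^ 3 := by ext y; ring
      rw [hf]
      have h := (((hs1.mul hs1).const_mul (T ^ 2 / a)).add (hs1.const_mul (2 * T / a ^ 2))).add_const (2 / a ^ 3)
      refine h.congr_deriv ?_
      ring
    have hβ : HasDerivAt (fun s : ℝ => 2 * T ^ 2 * s / a + 2 * T / a ^ 2) (2 * T ^ 2 / a) s := by
      have hf : (fun s : ℝ => 2 * T ^ 2 * s / a + 2 * T / a ^ 2) = fun s => 2 * T ^ 2 / a * s + 2 * T / a ^ 2 := by ext y; ring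
      rw [hf]
      have h := (hs1.const_mul (2 * T ^ 2 / a)).add_const (2 * T / a ^ 2)
      refine h.congr_deriv ?_
      ring
    have h3 : HasDerivAt (fun s : ℝ => (T ^ 2 * s ^ 2 / a + 2 * T * s / a ^ 2 + 2 / a ^ 3) * A s -
        (2 * T ^ 2 * s / a + 2 * T / a ^ 2) * B s + T ^ 2 / a * C s)
        ((2 * T ^ 2 * s / a + 2 * T / a ^ 2) * A s + (T ^ 2 * s ^ 2 / a + 2 * T * s / a ^ 2 + 2 / a ^ 3) * (Real.exp ((T * a) * s) * ψ s)
          - ((2 * T ^ 2 / a) * B s + (2 * T ^ 2 * s / a + 2 * T / a ^ 2) * (Real.exp ((T * a) * s) * (s * ψ s)))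
          + T ^ 2 / a * (Real.exp ((T * a) * s) * (s ^ 2 * ψ s))) s :=
      ((hα.mul (hdA s)).sub (hβ.mul (hdB s))).add ((hdC s).const_mul (T ^ 2 / a))
    have h := h1.mul h3
    refine h.congr_deriv ?_
    have hE : Real.exp (-(T * a) * s) = (Real.exp ((T * a) * s))⁻¹ := by
      rw [← Real.exp_neg]; congr 1; ring
    rw [hE]
    have hpos : Real.exp ((T * a) * s) ≠ 0 := (Real.exp_pos _).ne'
    field_simp
    ring
  -- integrate `Φ'` over `[0, 1]`
  have hcΦ' : Continuous fun s => 2 * ψ s / a ^ 3 - T * (T ^ 2 * Real.exp (-(T * a) * s) * (s ^ 2 * A s - 2 * s * B s + C s)) := by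
    fun_prop
  have hftc := intervalIntegral.integral_eq_sub_of_hasDerivAt (fun s _ => hdΦ s) (hcΦ'.intervalIntegrable 0 1)
  rw [intervalIntegral.integral_sub ((by fun_prop : Continuous fun s => 2 * ψ s / a ^ 3).intervalIntegrable _ _)
      ((by fun_prop : Continuous fun s => T * (T ^ 2 * Real.exp (-(T * a) * s) * (s ^ 2 * A s - 2 * s * B s + C s))).intervalIntegrable _ _),
    intervalIntegral.integral_div, intervalIntegral.integral_const_mul, intervalIntegral.integral_const_mul] at hftc
  have hΦ0 : Φ 0 = 0 := by simp [hΦ, hA0, hB0, hC0]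
  -- `Φ 1 ≥ 0`
  have hΦ1 : 0 ≤ Φ 1 := by
    have e1 : Φ 1 = ∫ x in (0:ℝ)..1, ψ x * (((T * (1 - x)) ^ 2 / a + 2 * (T * (1 - x)) / a ^ 2 + 2 / a ^ 3) *
        Real.exp (-(T * (1 - x)) * a)) := by
      show Real.exp (-(T * a) * 1) * ((T ^ 2 * 1 ^ 2 / a + 2 * T * 1 / a ^ 2 + 2 / a ^ 3) * (∫ x in (0:ℝ)..1, Real.exp ((T * a) * x) * ψ x) -
          (2 * T ^ 2 * 1 / a + 2 * T / a ^ 2) * (∫ x in (0:ℝ)..1, Real.exp ((T * a) * x) * (x * ψ x)) +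
          T ^ 2 / a * ∫ x in (0:ℝ)..1, Real.exp ((T * a) * x) * (x ^ 2 * ψ x)) = _
      rw [← intervalIntegral.integral_const_mul, ← intervalIntegral.integral_const_mul, ← intervalIntegral.integral_const_mul,
        ← intervalIntegral.integral_sub ((hcA.intervalIntegrable _ _).const_mul _) ((hcB.intervalIntegrable _ _).const_mul _),
        ← intervalIntegral.integral_add (((hcA.intervalIntegrable _ _).const_mul _).sub ((hcB.intervalIntegrable _ _).const_mul _))
          ((hcC.intervalIntegrable _ _).const_mul _), ← intervalIntegral.integral_const_mul]
      refine intervalIntegral.integral_congr fun x _ => ?_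
      have he : Real.exp (-(T * (1 - x)) * a) = Real.exp (-(T * a) * 1) * Real.exp ((T * a) * x) := by
        rw [← Real.exp_add]; congr 1; ring
      simp only [he]
      ring
    rw [e1]
    refine intervalIntegral.integral_nonneg zero_le_one fun x hx => ?_
    have h1x : 0 ≤ 1 - x := by linarith [hx.2]
    exact mul_nonneg (hψ0 x hx) (by positivity)
  -- conclude
  have key : T * ∫ s in (0:ℝ)..1, ∫ x in (0:ℝ)..s, ψ x * ((T * (s - x)) ^ 2 * Real.exp (-(T * (s - x)) * a)) =
      T * ∫ s in (0:ℝ)..1, T ^ 2 * Real.exp (-(T * a) * s) * (s ^ 2 * A s - 2 * s * B s + C s) := by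
    congr 1
    exact intervalIntegral.integral_congr fun s _ => hbridge s
  rw [key]
  linarith

/-- Continuity of the inner second-moment integral for continuous `ψ`. [folklore] -/
theorem continuous_inner_moment2 (T a : ℝ) {ψ : ℝ → ℝ} (hψ : Continuous ψ) :
    Continuous fun s : ℝ => ∫ x in (0:ℝ)..s, ψ x * ((T * (s - x)) ^ 2 * Real.exp (-(T * (s - x)) * a)) := by
  have hf : Continuous (Function.uncurry fun s x : ℝ => ψ x * ((T * (s - x)) ^ 2 * Real.exp (-(T * (s - x)) * a))) := by
    exact (hψ.comp continuous_snd).mul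
      (by fun_prop : Continuous fun p : ℝ × ℝ => (T * (p.1 - p.2)) ^ 2 * Real.exp (-(T * (p.1 - p.2)) * a))
  exact intervalIntegral.continuous_parametric_intervalIntegral_of_continuous (a₀ := 0) hf continuous_id

/-- **SHARP UPPER BOUND FOR THE SECOND KERNEL MOMENT**: `h_T(a) = T∫₀¹a(s)∫₀ˢa(x)(T(s−x))²e^{−T(s−x)a}dxds ≤ 2ϑ_∞/a³`, `ϑ_∞ = 1 − 4ρ/3`
(`0 < ρ ≤ 1/2`, `T ≥ 0`, `a > 0`; AM–GM inside the non-negative kernel, `kernel_moment2_mass_le`, `kernel_moment2_dual_le`, `integral_trapezoid_sq`).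
This is the moment of `lowerEdge_second_order` (p654671): second-order lower edge loss `(τhi)²/8·h_T(lo) ≤ (τhi)²ϑ_∞/(4lo³)`. [folklore] -/
theorem qsRespMoment2_le {ρ T a : ℝ} (hρ : 0 < ρ) (hρ2 : ρ ≤ 1 / 2) (hT : 0 ≤ T) (ha : 0 < a) :
    T * ∫ s in (0:ℝ)..1, LatticeShear.LatticeWord.trapezoid 0 1 ρ s *
        ∫ x in (0:ℝ)..s, LatticeShear.LatticeWord.trapezoid 0 1 ρ x * ((T * (s - x)) ^ 2 * Real.exp (-(T * (s - x)) * a)) ≤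
      2 * (1 - 4 * ρ / 3) / a ^ 3 := by
  set φ : ℝ → ℝ := fun s => LatticeShear.LatticeWord.trapezoid 0 1 ρ s with hφ
  have hφc : Continuous φ := continuous_trapezoid_unit ρ
  have hK0 : ∀ s x : ℝ, x ≤ s → 0 ≤ (T * (s - x)) ^ 2 * Real.exp (-(T * (s - x)) * a) := fun s x _ =>
    mul_nonneg (sq_nonneg _) (Real.exp_pos _).le
  -- Step 1: AM–GM inside the kernel, pointwise in `s ∈ [0,1]`
  have hpt : ∀ s ∈ Icc (0:ℝ) 1, T * (φ s * ∫ x in (0:ℝ)..s, φ x * ((T * (s - x)) ^ 2 * Real.exp (-(T * (s - x)) * a))) ≤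
      φ s ^ 2 / a ^ 3 + T / 2 * ∫ x in (0:ℝ)..s, φ x ^ 2 * ((T * (s - x)) ^ 2 * Real.exp (-(T * (s - x)) * a)) := by
    intro s hs
    have hs0 : 0 ≤ s := hs.1
    have h1 : φ s * ∫ x in (0:ℝ)..s, φ x * ((T * (s - x)) ^ 2 * Real.exp (-(T * (s - x)) * a)) ≤
        ∫ x in (0:ℝ)..s, (φ s ^ 2 / 2 * ((T * (s - x)) ^ 2 * Real.exp (-(T * (s - x)) * a)) +
          (1 / 2) * (φ x ^ 2 * ((T * (s - x)) ^ 2 * Real.exp (-(T * (s - x)) * a)))) := by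
      rw [← intervalIntegral.integral_const_mul]
      refine intervalIntegral.integral_mono_on hs0 ?_ ?_ fun x hx => ?_
      · exact (by fun_prop : Continuous fun x : ℝ =>
          φ s * (φ x * ((T * (s - x)) ^ 2 * Real.exp (-(T * (s - x)) * a)))).intervalIntegrable _ _
      · exact (by fun_prop : Continuous fun x : ℝ => φ s ^ 2 / 2 * ((T * (s - x)) ^ 2 * Real.exp (-(T * (s - x)) * a)) +
          (1 / 2) * (φ x ^ 2 * ((T * (s - x)) ^ 2 * Real.exp (-(T * (s - x)) * a)))).intervalIntegrable _ _
      · have hk := hK0 s x hx.2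
        nlinarith [sq_nonneg (φ s - φ x), hk]
    rw [intervalIntegral.integral_add
        ((by fun_prop : Continuous fun x : ℝ => φ s ^ 2 / 2 * ((T * (s - x)) ^ 2 * Real.exp (-(T * (s - x)) * a))).intervalIntegrable _ _)
        ((by fun_prop : Continuous fun x : ℝ =>
          (1 / 2) * (φ x ^ 2 * ((T * (s - x)) ^ 2 * Real.exp (-(T * (s - x)) * a)))).intervalIntegrable _ _),
      intervalIntegral.integral_const_mul, intervalIntegral.integral_const_mul] at h1
    have h2 := kernel_moment2_mass_le ha hT hs0
    have hφs : 0 ≤ φ s ^ 2 / 2 := by positivity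
    have h3 : T * (φ s ^ 2 / 2 * ∫ x in (0:ℝ)..s, (T * (s - x)) ^ 2 * Real.exp (-(T * (s - x)) * a)) ≤ φ s ^ 2 / a ^ 3 := by
      calc T * (φ s ^ 2 / 2 * ∫ x in (0:ℝ)..s, (T * (s - x)) ^ 2 * Real.exp (-(T * (s - x)) * a))
          = φ s ^ 2 / 2 * (T * ∫ x in (0:ℝ)..s, (T * (s - x)) ^ 2 * Real.exp (-(T * (s - x)) * a)) := by ring
        _ ≤ φ s ^ 2 / 2 * (2 / a ^ 3) := mul_le_mul_of_nonneg_left h2 hφs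
        _ = φ s ^ 2 / a ^ 3 := by ring
    nlinarith [mul_le_mul_of_nonneg_left h1 hT, h3]
  -- Step 2: integrate over `[0, 1]`
  have hJφ : Continuous fun s : ℝ => ∫ x in (0:ℝ)..s, φ x * ((T * (s - x)) ^ 2 * Real.exp (-(T * (s - x)) * a)) :=
    continuous_inner_moment2 T a hφc
  have hJψ : Continuous fun s : ℝ => ∫ x in (0:ℝ)..s, φ x ^ 2 * ((T * (s - x)) ^ 2 * Real.exp (-(T * (s - x)) * a)) :=
    continuous_inner_moment2 T a (hφc.pow 2)
  have hIl : IntervalIntegrable (fun s => T * (φ s * ∫ x in (0:ℝ)..s, φ x * ((T * (s - x)) ^ 2 * Real.exp (-(T * (s - x)) * a))))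
      volume 0 1 := (continuous_const.mul (hφc.mul hJφ)).intervalIntegrable _ _
  have hI1 : IntervalIntegrable (fun s => φ s ^ 2 / a ^ 3) volume 0 1 := ((hφc.pow 2).div_const _).intervalIntegrable _ _
  have hI2 : IntervalIntegrable (fun s => T / 2 * ∫ x in (0:ℝ)..s, φ x ^ 2 * ((T * (s - x)) ^ 2 * Real.exp (-(T * (s - x)) * a)))
      volume 0 1 := (continuous_const.mul hJψ).intervalIntegrable _ _
  have hmono := intervalIntegral.integral_mono_on zero_le_one hIl (hI1.add hI2) hpt
  rw [intervalIntegral.integral_const_mul, intervalIntegral.integral_add hI1 hI2,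
    intervalIntegral.integral_div, intervalIntegral.integral_const_mul] at hmono
  -- Step 3: the dual half
  have hdual := kernel_moment2_dual_le ha hT (ψ := fun x => φ x ^ 2) (hφc.pow 2) (fun x _ => sq_nonneg (φ x))
  have hsq : ∫ s in (0:ℝ)..1, φ s ^ 2 = 1 - 4 * ρ / 3 := by
    have := integral_trapezoid_sq one_pos hρ hρ2
    rw [one_mul] at this
    exact this
  rw [hsq] at hmono hdual
  -- Step 4: assemble
  have ha3 : 0 < a ^ 3 := by positivity
  calc T * ∫ s in (0:ℝ)..1, φ s * ∫ x in (0:ℝ)..s, φ x * ((T * (s - x)) ^ 2 * Real.exp (-(T * (s - x)) * a))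
      ≤ (1 - 4 * ρ / 3) / a ^ 3 + T / 2 * ∫ s in (0:ℝ)..1, ∫ x in (0:ℝ)..s,
          φ x ^ 2 * ((T * (s - x)) ^ 2 * Real.exp (-(T * (s - x)) * a)) := hmono
    _ ≤ (1 - 4 * ρ / 3) / a ^ 3 + (1 / 2) * (2 * (1 - 4 * ρ / 3) / a ^ 3) := by nlinarith [hdual]
    _ = 2 * (1 - 4 * ρ / 3) / a ^ 3 := by field_simp; ring

end SecondMoment


end Summit.AnomalousDissipation.AnomalousDissipation.Theorems.SolenoidalFractalHomogenisation.LagrangianStep.OddGain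

end
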